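import Literature.MathematicalPhysics.QuantumFieldTheory.Balaban1983to89.B9WalkLettersOpsLocality
import Literature.MathematicalPhysics.QuantumFieldTheory.Balaban1983to89.B9Thm311LocalInversePosY
import Literature.MathematicalPhysics.QuantumFieldTheory.Balaban1983to89.Node00.OpsYRecordV5
import Literature.MathematicalPhysics.QuantumFieldTheory.Balaban1983to89.Node00.OpsYSectDCoords
import Literature.MathematicalPhysics.QuantumFieldTheory.Balaban1983to89.B9BackgroundsKLevelV1R

/-!
# BalabanUVNodes ∕ N06 ([B9], `Dag.B9_main`) — THE rows-18 WALK LETTERS OF RECORD AT THE CERTIFICATE'S FIBRE: `h36`'s `Identities₂` CONJUNCT AND `hloc`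
# FOR `SU(N)`-VALUED CONFIGURATIONS (inputs of the W-a edition of the stage-11 certificate)

Track A of `YM-PLAN.md` (cell `pub-ymgap`, HUMAN RULING D-0062), node **N06** = [Balaban1985BackgroundPropagators] Thms 3.1–3.15; seat `pub-ymgap-dag-n06-d`
(gen 15), the knit at the ₁₁ record.  WHY.  Edition 46 of the certificate (`…AtOpsYNuOfRecordV6EPairOA`, R-generic body `…V6EPairNZ`) DISPLAYS the rows-18 walk
letters (3.87)–(3.90) as FREE binders `𝔬 𝔡 𝔩 κ` with ten `rfl`-shaped pins and the static ∕ algebraic hypotheses `hst hκ hloc` + `h36`'s `Identities₂` conjunct.  The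
W-a programme (this seat, `Literature/…/B9WalkLettersOps ∕ OpsFacts ∕ OpsLocality`) built THE RECORD the pins describe (`opsWalkY`, `dirOpsWalkY`, `dirLettersWalkY`,
`kappaWalkY`, `rdWalkY`) and proved `staticOK_opsWalkY`, `bounded_kappaWalkY`, `identities₂_opsWalkY` (transporter contraction, `c_R ≠ 0` and the units of (3.27)
DISPLAYED) and `localityDir_opsWalkY` (hypothesis-free).  This file closes the two residual inputs AT THE CERTIFICATE'S FIBRE `M_N(ℂ)`, `G = SU(N)`, transporter
`parSymY`, basis `trBasis N`:
* §1 `localityDir_of_agree_eq` — `LocalityDir` reads the walk reading only through its `Agree` field; ★ `localityDir_opsWalkY_of_agree` — any reading `rd` whose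
  `Agree` IS `agreeWalkY` inherits `localityDir_opsWalkY` (the certificate keeps `rd` displayed with this ONE pin until dag-n06-c's `WalkReading.OKRel` lands —
  node00-def-Y's ruling on WORD-W1, bus l.42897);
* §2 ★★ `identities₂_opsWalkY_SU` — `Identities₂ (opsWalkY …) (dirOpsWalkY …) (dirLettersWalkY …) R H U` for EVERY `SU(N)`-valued configuration (`N ≥ 1`), any
  `R`, `H`: the contraction pairs are `‖u‖ ≤ 1` for `u ∈ SU(N) ⊂ U(N)` (node00-def-Y `norm_coe_le_one_specialUnitaryUnits`, `parSymY_mem`), the units of (3.27)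
  are dag-n06-j's `isUnit_deltaPrimeAY_parSymY` ∕ `isUnit_padDeltaY_parSymY` (Thm 3.11's positivity, no regularity needed), `c_R > 0` is node00-def-Y's
  `cR39_trBasis_pos`; ★ `identities₂_opsWalkY_of_reg335R` — the same read from a membership `(bg9YR … R₁ R₂ x).Reg335 c α₀ U` of a `G`-valued family
  (`mem_of_reg335R`), the shape the certificate's `h36` premises carry.
HONEST FRAMING.  Assembly of landed facts (kernel bookkeeping); nothing of [B9]'s analysis asserted; the (3.42) content of rows 18 (`h36`'s `Local342`, `h36H`)
REMAINS displayed by the certificate; COUNT-NEUTRAL; N06 NOT discharged; K1⁹ NOT closed; one finite 𝕋⁴ programme at fixed `ε` — NOT continuum ∕ OS ∕ mass gap ∕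
Clay.  0 `def`, 0 `sorry`.
-/

noncomputable section

namespace Summit.QuantumFields.YangMills.BalabanUVNodes.N06WalkLettersAtRecordR

open Literature.MathematicalPhysics.QuantumFieldTheory.Balaban1983to89
open Literature.MathematicalPhysics.QuantumFieldTheory.Balaban1983to89.Node00
open Literature.MathematicalPhysics.QuantumFieldTheory.Balaban1983to89.B6KLevelCensusIndexV1 (KIdx)
open Literature.MathematicalPhysics.QuantumFieldTheory.Balaban1983to89.B6Ineq2142KLevelV1 (β lvl)
open Literature.MathematicalPhysics.QuantumFieldTheory.Balaban1983to89.B6Cover236MultiLevelBlocks (cubes)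
open Literature.MathematicalPhysics.QuantumFieldTheory.Balaban1983to89.B9PinMembersKLevelV1 (MemberY geo9Y)
open Literature.MathematicalPhysics.QuantumFieldTheory.Balaban1983to89.B7Prop2SpecialUnitary (specialUnitaryUnits specialUnitaryUnits_le_unitaryUnits)
open Literature.MathematicalPhysics.QuantumFieldTheory.Balaban1983to89.B9Thm37Whole (Ops)
open Literature.MathematicalPhysics.QuantumFieldTheory.Balaban1983to89.B9RWSums346SecondDiffGp (DirOps37)
open Literature.MathematicalPhysics.QuantumFieldTheory.Balaban1983to89.B9Thm37WholeDir (DirLetters37 Identities₂)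
open Literature.MathematicalPhysics.QuantumFieldTheory.Balaban1983to89.B9Cor38Whole (WalkReading)
open Literature.MathematicalPhysics.QuantumFieldTheory.Balaban1983to89.B9Cor38WholeDir (LocalityDir)
open Literature.MathematicalPhysics.QuantumFieldTheory.Balaban1983to89.B9CoReadingCoordsTranspose (TrIdx trBasis)
open Literature.MathematicalPhysics.QuantumFieldTheory.Balaban1983to89.B9BackgroundsKLevelV1R (RegFamY MemOfFam bg9YR mem_of_reg335R)
open Literature.MathematicalPhysics.QuantumFieldTheory.Balaban1983to89.B9Thm311DeltaPrimePos (isUnit_deltaPrimeAY_parSymY)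
open Literature.MathematicalPhysics.QuantumFieldTheory.Balaban1983to89.B9Thm311LocalInversePosY (isUnit_padDeltaY_parSymY)
open Literature.MathematicalPhysics.QuantumFieldTheory.Balaban1983to89.Node00.OpsYSectDCoords (cR39_trBasis_pos)
open Literature.MathematicalPhysics.QuantumFieldTheory.Balaban1983to89.B9WalkLettersCoordsS (cubeDomY)
open Literature.MathematicalPhysics.QuantumFieldTheory.Balaban1983to89.B9WalkLettersOps (opsWalkY dirOpsWalkY dirLettersWalkY agreeWalkY rdWalkY)
open Literature.MathematicalPhysics.QuantumFieldTheory.Balaban1983to89.B9WalkLettersOpsFacts (identities₂_opsWalkY)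
open Literature.MathematicalPhysics.QuantumFieldTheory.Balaban1983to89.B9WalkLettersOpsLocality (localityDir_opsWalkY)

/-! ## §1 `LocalityDir` reads the walk reading through `Agree` only -/

section Agree

variable {g : B9.Geometry} {B : B9.Backgrounds} {X Y ι Dir : Type} [Fintype Dir]

/-- `LocalityDir` mentions the walk reading only through `rd.Agree`: a reading with the same agreement predicate inherits it.
[cite: Balaban1985BackgroundPropagators, Cor. 3.8 p.410 L14–15, bookkeeping] -/
theorem localityDir_of_agree_eq {𝔬 : Ops g B X Y ι} {𝔡 : DirOps37 𝔬 Dir} {𝔩 : DirLetters37 𝔬 Dir} {rd rd' : WalkReading g B X ι}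
    (h : rd.Agree = rd'.Agree) (hl : LocalityDir 𝔬 𝔡 𝔩 rd') : LocalityDir 𝔬 𝔡 𝔩 rd :=
  ⟨fun q U U' hA => hl.gsq q U U' (by rw [h] at hA; exact hA), fun q U U' hA => hl.kgh q U U' (by rw [h] at hA; exact hA)⟩

end Agree

section Record

variable {d ℓ : ℕ} {hd : 1 ≤ d + 1} {hL : Odd (ℓ + 1) ∧ 1 < ℓ + 1} {b₀ b₁ : ℝ} {Mstar : ℕ}
variable {𝔸 : Type} [NormedRing 𝔸] [NormedAlgebra ℂ 𝔸] [CompleteSpace 𝔸] [FiniteDimensional ℝ 𝔸] {κ : Type} [Fintype κ] [DecidableEq κ]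
variable (x : MemberY d ℓ hd hL b₀ b₁ Mstar) (b : Module.Basis κ ℝ 𝔸) (B : B9.Backgrounds) (cfg : B.Cfg → CfgY 𝔸 x.toKIdx) (parS : SiteParY 𝔸 x.toKIdx)
variable (bI : FBondY x.toKIdx → IBondY x.toKIdx)

/-- ★ **`hloc` AT THE RECORD FOR A DISPLAYED READING WHOSE `Agree` IS PINNED**: any walk reading `rd` with `rd.Agree = agreeWalkY …` satisfies
`LocalityDir (opsWalkY …) (dirOpsWalkY …) (dirLettersWalkY …) rd` (from the hypothesis-free `localityDir_opsWalkY` at `rdWalkY`).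
[cite: Balaban1985BackgroundPropagators, Cor. 3.8 p.410 L14–15 («G′_□ depends on U restricted to Ω₀(□) ⊂ □̃⁵, and the operator K(h) is semi-local»)] -/
theorem localityDir_opsWalkY_of_agree (rd : WalkReading (geo9Y x) B (B9CoReadingCoordsS.XSK κ x.toKIdx) ↥(cubes x.toKIdx.D.toDomains))
    (h : rd.Agree = agreeWalkY x B cfg parS) :
    LocalityDir (opsWalkY x b B cfg parS bI) (dirOpsWalkY x b B cfg parS bI) (dirLettersWalkY x b B cfg parS bI) rd :=
  localityDir_of_agree_eq (rd' := rdWalkY x B cfg parS) h (localityDir_opsWalkY x b B cfg parS bI)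

end Record

/-! ## §2 `Identities₂` at the record for `SU(N)`-valued configurations -/

section SU

open scoped Matrix.Norms.L2Operator

variable {d ℓ : ℕ} {hd : 1 ≤ d + 1} {hL : Odd (ℓ + 1) ∧ 1 < ℓ + 1} {b₀ b₁ : ℝ} {Mstar : ℕ} {N : ℕ} [NeZero N]
variable (x : MemberY d ℓ hd hL b₀ b₁ Mstar) (B : B9.Backgrounds) (cfg : B.Cfg → CfgY (Matrix (Fin N) (Fin N) ℂ) x.toKIdx)
variable (bI : FBondY x.toKIdx → IBondY x.toKIdx) [Fintype (geo9Y x).Site]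

/-- ★★ **`h36`'s `Identities₂` CONJUNCT AT THE RECORD FOR EVERY `SU(N)`-VALUED CONFIGURATION**: at the certificate's fibre (`M_N(ℂ)`, basis `trBasis N`, transporter
`parSymY`) the displayed hypotheses of `identities₂_opsWalkY` are theorems — contraction of the bond variables and averaging transporters (`SU(N) ⊂ U(N)`), the units
`Δ′_a(U)`, `P_□Δ′_a(U)P_□ + (1 − P_□)` of (3.27) (Thm 3.11's positivity), `c_R > 0`.
[cite: Balaban1985BackgroundPropagators, (3.87)–(3.88) pp.408–409, (3.100) p.413, (3.25)–(3.27) p.395, Thm 3.11 p.416; Balaban1984PropagatorsII, (2.39)–(2.40) pp.229–230] -/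
theorem identities₂_opsWalkY_SU (R : ℝ) (H : Prop)
    (hβ1 : ∀ f : FBondY x.toKIdx, (B6Geom246MultiLevelTorus.geomT x.D).dist (β x.hN x.D x.hk (bI f)) (B6GlobalChartV1.blkV1 x.hN x.D f) ≤ 1)
    (hlev : ∀ f : FBondY x.toKIdx, lvl x.hN x.D x.hk (bI f) = (B6GlobalChartV1.blkV1 x.hN x.D f).1.1)
    (U : B.Cfg) (hU : ∀ μ y, cfg U μ y ∈ specialUnitaryUnits (Fin N)) :
    Identities₂ (opsWalkY x (trBasis N) B cfg (parSymY x.toKIdx) bI) (dirOpsWalkY x (trBasis N) B cfg (parSymY x.toKIdx) bI)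
      (dirLettersWalkY x (trBasis N) B cfg (parSymY x.toKIdx) bI) R H U := by
  have h1 := fun (g : (Matrix (Fin N) (Fin N) ℂ)ˣ) (hg : g ∈ specialUnitaryUnits (Fin N)) => norm_coe_le_one_specialUnitaryUnits g hg
  have hbox : ∀ (μ : Fin (d + 1)) (w : SiteY x.toKIdx), UboxY x.toKIdx (cfg U) μ w ∈ specialUnitaryUnits (Fin N) := fun μ w => hU μ _
  have havg : ∀ z w : SiteY x.toKIdx, avgTrY x.toKIdx (parSymY x.toKIdx) (cfg U) z w ∈ specialUnitaryUnits (Fin N) := fun z w =>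
    Subgroup.mul_mem _ (parSymY_mem x.toKIdx hU _ _) (parSymY_mem x.toKIdx hU _ _)
  exact identities₂_opsWalkY x (trBasis N) B cfg (parSymY x.toKIdx) bI R H hβ1 hlev (cR39_trBasis_pos (NeZero.pos N)).ne' U
    (fun μ w => ⟨h1 _ (hbox μ w), h1 _ (Subgroup.inv_mem _ (hbox μ w))⟩)
    (fun z w => ⟨h1 _ (havg z w), h1 _ (Subgroup.inv_mem _ (havg z w))⟩)
    (isUnit_deltaPrimeAY_parSymY x.toKIdx specialUnitaryUnits_le_unitaryUnits hU)
    (fun c => isUnit_padDeltaY_parSymY x.toKIdx specialUnitaryUnits_le_unitaryUnits hU (cubeDomY x c))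

/-- ★ **… READ FROM A (3.35)-MEMBERSHIP OF A `G`-VALUED REGULARITY FAMILY** (the certificate's carrier `bg9YR M_N(ℂ) SU(N) R₁ R₂`, configurations `cfg := id`):
the shape of the premises of the certificate's `h36`. [cite: Balaban1985BackgroundPropagators, (3.35) p.396 («U with values in G»), (3.87)–(3.88) pp.408–409] -/
theorem identities₂_opsWalkY_of_reg335R {R₁ R₂ : RegFamY d ℓ hd hL b₀ b₁ Mstar (Matrix (Fin N) (Fin N) ℂ)} (hGR : MemOfFam (specialUnitaryUnits (Fin N)) R₁)
    (R : ℝ) (H : Prop)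
    (hβ1 : ∀ f : FBondY x.toKIdx, (B6Geom246MultiLevelTorus.geomT x.D).dist (β x.hN x.D x.hk (bI f)) (B6GlobalChartV1.blkV1 x.hN x.D f) ≤ 1)
    (hlev : ∀ f : FBondY x.toKIdx, lvl x.hN x.D x.hk (bI f) = (B6GlobalChartV1.blkV1 x.hN x.D f).1.1)
    {c α₀ : ℝ} {U : (bg9YR (Matrix (Fin N) (Fin N) ℂ) (specialUnitaryUnits (Fin N)) R₁ R₂ x).Cfg}
    (hU : (bg9YR (Matrix (Fin N) (Fin N) ℂ) (specialUnitaryUnits (Fin N)) R₁ R₂ x).Reg335 c α₀ U) :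
    Identities₂ (opsWalkY x (trBasis N) (bg9YR (Matrix (Fin N) (Fin N) ℂ) (specialUnitaryUnits (Fin N)) R₁ R₂ x) (fun U => U) (parSymY x.toKIdx) bI)
      (dirOpsWalkY x (trBasis N) (bg9YR (Matrix (Fin N) (Fin N) ℂ) (specialUnitaryUnits (Fin N)) R₁ R₂ x) (fun U => U) (parSymY x.toKIdx) bI)
      (dirLettersWalkY x (trBasis N) (bg9YR (Matrix (Fin N) (Fin N) ℂ) (specialUnitaryUnits (Fin N)) R₁ R₂ x) (fun U => U) (parSymY x.toKIdx) bI) R H U :=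
  identities₂_opsWalkY_SU x (bg9YR (Matrix (Fin N) (Fin N) ℂ) (specialUnitaryUnits (Fin N)) R₁ R₂ x) (fun U => U) bI R H hβ1 hlev U (mem_of_reg335R hGR x hU)

end SU

end Summit.QuantumFields.YangMills.BalabanUVNodes.N06WalkLettersAtRecordR

end
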